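import Literature.NumberTheory.DiophantineGeometry.GenEllFullGalois
import Literature.NumberTheory.DiophantineGeometry.GenEllMellProofs
import Literature.NumberTheory.EllipticCurves.HeightsBaseChangeProofs
import Mathlib.AlgebraicGeometry.EllipticCurve.ModelsWithJ
import HarnessLib

/-!
# [GenEll] §3: compactly bounded subsets bound `ht_∞ − deg_∞`; height-bounded exceptional sets are Galois-finite

S. Mochizuki, *Arithmetic elliptic curves in general position*, Math. J. Okayama Univ. **52** (2010)
[cite: MochizukiGenEll2010], proof of Lemma 3.7 (pp. 18–19):

> […] the fact that `[E_L] ∈ K_V` implies that `ht_∞([E_L])` is bounded […], so, by Proposition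
> 1.4, (iv), `[E_L]` belongs to some [fixed] finite exceptional set `Exc_d` [which we think of as
> `Exc ∩ M_ell(Q̄)^{≤d}`] […] Recall that by definition, `ht_∞([E_L])` may be computed as the sum of
> `deg_∞([E_L])` and an archimedean term which, in the present situation, is bounded, since
> `[E_L] ∈ K_V`.

In the tree's rendering (`GenEllMell.lean`, `GenEllFullGalois.lean`): `ht_∞ = [F:ℚ]⁻¹·h_F(j)`,
`deg_∞ = [F:ℚ]⁻¹·log N(𝔇_j)`, `h_F(j) = log N(𝔇_j) + Σ_{σ : F → ℂ} log max(|σ j|, 1)` (Silverman 1986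
eq. (10), tree `logHeight₁_j_eq_sum_embeddings`), `[E] ∈ K_V` = every complex conjugate of `j` lies in
the compact `K_∞` (`MellCBData.Mem`), exceptional sets are sets of minimal polynomials of `j`
(`MellExcMem`, `MellExcGaloisFinite`).  PROVED here:

* `MellCBData.exists_htInf_le_degInf_add` — `∃ A ≥ 0, [E] ∈ K_V ⇒ ht_∞([E]) ≤ deg_∞([E]) + A`;
* `EllPoint.exists_repr_adjoin` — every presented point has a presentation over `ℚ(j)` with the same
  minimal polynomial of `j`, degree `deg minpoly_ℚ(j)` and the SAME `ht_∞` (`h_L = [L:K]·h_K`);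
* `mellExcGaloisFinite_htInfLe` — the exceptional set `{minpoly_ℚ(j_E) : ht_∞([E]) ≤ B}` is
  Galois-finite (Prop. 1.4 (iv) = tree `northcott_htInf`, after re-presenting over `ℚ(j)`).

Proof-only; no definitions.
-/

noncomputable section

namespace Literature.NumberTheory.DiophantineGeometry.GenEll

open _root_.NumberField _root_.Height Module
open scoped NumberField IntermediateField

/-! ## `[E] ∈ K_V` bounds the archimedean part of `ht_∞` -/

/-- **`ht_∞ ≤ deg_∞ + A(K_V)` on a compactly bounded subset** ([GenEll] proof of Lemma 3.7, p. 19: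
"`ht_∞([E_L])` may be computed as the sum of `deg_∞([E_L])` and an archimedean term which […] is
bounded, since `[E_L] ∈ K_V`"): with `|z| ≤ R` on the compact `K_∞`, every archimedean term
`log max(|σ j|, 1)` is `≤ log max(R, 1)`, and there are `[F:ℚ]` of them.
[cite: MochizukiGenEll2010, Lem 3.7 p.19] -/
theorem MellCBData.exists_htInf_le_degInf_add (D : MellCBData) :
    ∃ A : ℝ, 0 ≤ A ∧ ∀ P : EllPoint, D.Mem P → P.htInf ≤ P.degInf + A := by
  obtain ⟨R, hR⟩ := isBounded_iff_forall_norm_le.mp D.Karc_isCompact.isBounded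
  refine ⟨Real.log (max R 1), Real.log_nonneg (le_max_right _ _), fun P hP => ?_⟩
  have hσ : ∀ σ : P.F →+* ℂ, Real.log (max ‖σ P.W.j‖ 1) ≤ Real.log (max R 1) := fun σ =>
    Real.log_le_log (lt_max_of_lt_right one_pos) (max_le_max (hR _ (hP.1 σ)) le_rfl)
  unfold EllPoint.htInf EllPoint.degInf
  rw [logHeight₁_j_eq_sum_embeddings P.W]
  have hcard : (Finset.univ : Finset (P.F →+* ℂ)).card = P.degree := by
    rw [Finset.card_univ, NumberField.Embeddings.card]; rfl
  have hsum : ∑ σ : P.F →+* ℂ, Real.log (max ‖σ P.W.j‖ 1) ≤ P.degree * Real.log (max R 1) := by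
    calc ∑ σ : P.F →+* ℂ, Real.log (max ‖σ P.W.j‖ 1)
        ≤ ∑ _σ : P.F →+* ℂ, Real.log (max R 1) := Finset.sum_le_sum fun σ _ => hσ σ
      _ = P.degree * Real.log (max R 1) := by rw [Finset.sum_const, nsmul_eq_mul, hcard]
  have hd : (0 : ℝ) < P.degree := Nat.cast_pos.mpr P.degree_pos
  have h1 : (P.degree : ℝ)⁻¹ * ∑ σ : P.F →+* ℂ, Real.log (max ‖σ P.W.j‖ 1) ≤
      Real.log (max R 1) := by
    rw [inv_mul_le_iff₀ hd]; exact hsum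
  rw [mul_add]
  linarith

/-! ## Re-presentation over `ℚ(j)` and Galois-finiteness of height-bounded exceptional sets -/

namespace EllPoint

/-- **Re-presentation over `ℚ(j)`**: the point `[E] ∈ M_ell(Q̄)` presented by `(F, W)` is also
presented by `(ℚ(j_W), W_j)` with `W_j` Mathlib's model `ofJ` of `j`-invariant `j_W ∈ ℚ(j_W) ⊆ F`; the
minimal polynomial of `j` is unchanged, the degree becomes `deg minpoly_ℚ(j)`, and the normalised
height `ht_∞ = [F:ℚ]⁻¹·h_F(j)` is unchanged (`h_F(j) = [F:ℚ(j)]·h_{ℚ(j)}(j)`, Silverman AEC VIII.5.4(b)).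
[cite: MochizukiGenEll2010, Ex 1.3 (i) p.5] -/
theorem exists_repr_adjoin (P : EllPoint) :
    ∃ P₀ : EllPoint, minpoly ℚ P₀.W.j = minpoly ℚ P.W.j ∧
      P₀.degree = (minpoly ℚ P.W.j).natDegree ∧ P₀.htInf = P.htInf := by
  classical
  refine ⟨{ F := ℚ⟮P.W.j⟯, W := WeierstrassCurve.ofJ (IntermediateField.AdjoinSimple.gen ℚ P.W.j) },
    ?_, ?_, ?_⟩
  · show minpoly ℚ (WeierstrassCurve.ofJ (IntermediateField.AdjoinSimple.gen ℚ P.W.j)).j =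
      minpoly ℚ P.W.j
    rw [WeierstrassCurve.ofJ_j]
    exact IntermediateField.minpoly_gen ℚ P.W.j
  · show finrank ℚ ℚ⟮P.W.j⟯ = (minpoly ℚ P.W.j).natDegree
    exact IntermediateField.adjoin.finrank (Algebra.IsIntegral.isIntegral P.W.j)
  · show (finrank ℚ ℚ⟮P.W.j⟯ : ℝ)⁻¹ *
        logHeight₁ (WeierstrassCurve.ofJ (IntermediateField.AdjoinSimple.gen ℚ P.W.j)).j =
      (finrank ℚ P.F : ℝ)⁻¹ * logHeight₁ P.W.j
    rw [WeierstrassCurve.ofJ_j]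
    have hgen : algebraMap ℚ⟮P.W.j⟯ P.F (IntermediateField.AdjoinSimple.gen ℚ P.W.j) = P.W.j :=
      IntermediateField.AdjoinSimple.algebraMap_gen ℚ P.W.j
    have hbc : logHeight₁ P.W.j =
        finrank ℚ⟮P.W.j⟯ P.F * logHeight₁ (IntermediateField.AdjoinSimple.gen ℚ P.W.j) := by
      have h := NumberField.logHeight₁_algebraMap (K := ℚ⟮P.W.j⟯) (L := P.F)
        (IntermediateField.AdjoinSimple.gen ℚ P.W.j)
      rwa [hgen] at h
    have htower : (finrank ℚ P.F : ℝ) = finrank ℚ ℚ⟮P.W.j⟯ * finrank ℚ⟮P.W.j⟯ P.F := by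
      rw [← Module.finrank_mul_finrank ℚ ℚ⟮P.W.j⟯ P.F, Nat.cast_mul]
    have h2 : (0 : ℝ) < finrank ℚ⟮P.W.j⟯ P.F := Nat.cast_pos.mpr finrank_pos
    rw [hbc, htower, mul_inv, mul_assoc, inv_mul_cancel_left₀ h2.ne']

end EllPoint

/-- Membership in the height-bounded exceptional set `{minpoly_ℚ(j_E) : ht_∞([E]) ≤ B}`.
[cite: MochizukiGenEll2010, Lem 3.7 p.18] -/
theorem mellExcMem_htInfLe {B : ℝ} (P : EllPoint) (h : P.htInf ≤ B) :
    MellExcMem {f | ∃ Q : EllPoint, minpoly ℚ Q.W.j = f ∧ Q.htInf ≤ B} P :=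
  ⟨P, rfl, h⟩

/-- **The height-bounded exceptional set `{minpoly_ℚ(j_E) : ht_∞([E]) ≤ B}` is Galois-finite**
([GenEll] proof of Lemma 3.7: "by Proposition 1.4, (iv), `[E_L]` belongs to some [fixed] finite
exceptional set `Exc_d` [which we think of as `Exc ∩ M_ell(Q̄)^{≤d}`]"): in each degree `d`, re-present
over `ℚ(j)` (degree `≤ d`, same `ht_∞`) and apply the uniform Northcott property `northcott_htInf`.
[cite: MochizukiGenEll2010, Lem 3.7 p.18] -/
theorem mellExcGaloisFinite_htInfLe (B : ℝ) :
    MellExcGaloisFinite {f | ∃ Q : EllPoint, minpoly ℚ Q.W.j = f ∧ Q.htInf ≤ B} := by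
  intro d
  refine (northcott_htInf d B).subset ?_
  rintro f ⟨⟨P, hPf, hPB⟩, hfd⟩
  obtain ⟨P₀, h1, h2, h3⟩ := P.exists_repr_adjoin
  refine ⟨P₀, ⟨?_, ?_⟩, ?_⟩
  · show P₀.degree ≤ d
    rw [h2, hPf]; exact hfd
  · show P₀.htInf ≤ B
    rw [h3]; exact hPB
  · show minpoly ℚ P₀.W.j = f
    rw [h1, hPf]

/-! ## The archimedean bound from a bound on the conjugates of `j` alone -/

/-- **`ht_∞ ≤ deg_∞ + log max(R, 1)` whenever every complex conjugate of `j(E)` has absolute value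
`≤ R`** — the pointwise form of `MellCBData.exists_htInf_le_degInf_add`, usable for compactly bounded
subsets given in other coordinates (e.g. the `λ`-line of [IUTchIV] Cor. 2.2, where `|j(λ)|` is bounded
on `K_∞`): `h_F(j) = log N(𝔇_j) + Σ_{σ : F → ℂ} log max(|σ j|, 1)` and there are `[F:ℚ]` embeddings.
[cite: MochizukiGenEll2010, Lem 3.7 p.19] -/
theorem EllPoint.htInf_le_degInf_add_of_norm_le (P : EllPoint) {R : ℝ}
    (hR : ∀ σ : P.F →+* ℂ, ‖σ P.W.j‖ ≤ R) : P.htInf ≤ P.degInf + Real.log (max R 1) := by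
  have hσ : ∀ σ : P.F →+* ℂ, Real.log (max ‖σ P.W.j‖ 1) ≤ Real.log (max R 1) := fun σ =>
    Real.log_le_log (lt_max_of_lt_right one_pos) (max_le_max (hR σ) le_rfl)
  unfold EllPoint.htInf EllPoint.degInf
  rw [logHeight₁_j_eq_sum_embeddings P.W]
  have hcard : (Finset.univ : Finset (P.F →+* ℂ)).card = P.degree := by
    rw [Finset.card_univ, NumberField.Embeddings.card]; rfl
  have hsum : ∑ σ : P.F →+* ℂ, Real.log (max ‖σ P.W.j‖ 1) ≤ P.degree * Real.log (max R 1) := by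
    calc ∑ σ : P.F →+* ℂ, Real.log (max ‖σ P.W.j‖ 1)
        ≤ ∑ _σ : P.F →+* ℂ, Real.log (max R 1) := Finset.sum_le_sum fun σ _ => hσ σ
      _ = P.degree * Real.log (max R 1) := by rw [Finset.sum_const, nsmul_eq_mul, hcard]
  have hd : (0 : ℝ) < P.degree := Nat.cast_pos.mpr P.degree_pos
  have h1 : (P.degree : ℝ)⁻¹ * ∑ σ : P.F →+* ℂ, Real.log (max ‖σ P.W.j‖ 1) ≤
      Real.log (max R 1) := by
    rw [inv_mul_le_iff₀ hd]; exact hsum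
  rw [mul_add]
  linarith

end Literature.NumberTheory.DiophantineGeometry.GenEll

end
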